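import Summits.QuantumFields.YangMills.Theorems.UnitScaleTiltProp8ChartDoubleBarIterSmall
import Summits.QuantumFields.YangMills.Theorems.UnitScaleTiltProp8ChartDiffBall
import HarnessLib

/-!
# Route `UnitScaleTilt`, crux K1 «MinimiserStabilityRegPr» (stmt-QuantumFields-19200), leaf V2′ `stub_halvingStep` — pillar P3 re-based on print's DOUBLE-BAR chart
# (★★OWNER RULING g26-№6, (S3) brick B2 part 2): **hCd♭ — THE DOUBLE-BAR CONSTRAINT MAP `chartLogFlat η D` IS ℂ-DIFFERENTIABLE ON THE WEIGHTED SUP-BALL WITH A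
# k-UNIFORM RADIUS, AND ITS k-UNIFORM SUP LETTER `‖chartLogFlat η D A (j,c)‖ ≤ 8·L·R`** (the inputs of brick B3's Cauchy estimate = hCq♭)

Cell `ym3-torus` (HUMAN RULING D-0037, YM ladder rung R3 — continuum SU(2) YM₃ on the torus is a RUNG, not the Clay problem), width seat `ym-ust-19200-w5` gen 3,
LEAD of (S3).  `--supports stmt-QuantumFields-19200 --as helper`; def-free, 0 sorry, standard axioms.

WHAT THIS FILE PROVES (the ♭ twin of ✓`…ChartDiffBall`, same architecture; the one-step ♭ letter `hstep` of brick B1 with its constant `C₁ ≥ 2` displayed, as in part 1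
✓`norm_dbarIterU_sub_one_le_of_reads`).
* §1 local differentiability of the ♭ building blocks in a parameter: `norm_stairHol_sub_one_lt_one`, `differentiableAt_coe_vframeU_of_block` (the block frame
  `v(y) = eml(stair transporters)` — ✓`differentiableAt_eml` + ✓`differentiableAt_coe_holT_of_steps`, stairs inside the block by ✓`blockOf_ends_of_mem_stairWalk`),
  `differentiableAt_coe_dbarAvgU_of_twoBlock` (`U̿(c) = v(c₋)⁻¹·Ū(c)·v(c₊)`: product rule with ✓`differentiableAt_coe_emlAvgU_of_twoBlock`, ✓`differentiableAt_coe_inv`).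
* §2 ★ `differentiableAt_coe_dbarIterU_of_reads` — `A ↦ U̿^{(i)}(e^{iηA})(e)` is ℂ-differentiable at every `A₀` whose charted bond variables are within `s₀` of `1` on the
  fine bonds under `S ∋ e₋, e₊`, `8C₁ℓ²Lⁱs₀ ≤ 1` (induction `S ↦ B⁻¹S`; the loop and stair variables met on the way are within `8ℓ·Lⁱs₀ < 1` of `1` by part 1).
* §3 at an index: `differentiableAt_chartLogFlat_apply_of_reads`, `norm_chartLogFlat_apply_le_of_reads` (`‖chartLogFlat η D A₀ (j,c)‖ ≤ 4·Lʲ·s₀`).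
* §4 ★★ on the weighted ball of the F4 pen (`IsLevWeight`, `η = L^{−(K−n)}`, collar property ∕ `Adm22`), radius `16·C₁·ℓ²·L·R ≤ 1`:
  **`differentiableOn_chartLogFlat_weightedBall`** (hCd♭) and **`norm_chartLogFlat_le_weightedBall`**: `‖chartLogFlat η D A (j,c)‖ ≤ 8·L·R` — k-UNIFORM and, unlike
  the single-bar `120ℓ·L·R`, free of the comb factor `ℓ` (no comb accumulation in the ♭ iterate); `_of_adm22` variants.
HONEST SCOPE: brick B2 of (S3); B1 (`hstep`) and B3 (Cauchy ⇒ hCq♭) are separate files; nothing here is specific to `SU(2)` beyond §4's carrier.  NOT a claim about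
the mass gap.

References: T. Bałaban, CMP **102** (1985) 277–309 [Balaban1985Variational] ((18)–(21) pp.280–281, (44)–(48) p.285, (152)–(157) pp.301–302); CMP **98** (1985) 17–51
[Balaban1985Averaging] (Prop. 4 (134)–(135) p.38, (89) p.31, (110) p.34); CMP **109** (1987) 249–301 [Balaban1987RG1] ((0.4) p.253, (0.21) p.256).
-/

noncomputable section

open scoped BigOperators
open NormedSpace

namespace Summit.QuantumFields.YangMills.Theorems.Prop8ChartDoubleBar

open Literature.MathematicalPhysics.QuantumFieldTheory.Balaban1983to89
open T4Continuum BlockAveraging AveragingRT ExpMeanLog MatrixLog BlockAveragingEMLLinearised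
open B10Eq27TorusAxialLog (holT)
open B5Eq118OneStroke (iterBlockOf iterBlockOf_succ iterBlockOf_zero)
open B6SectADomainsV1 (Domains)
open B6SectAOperatorsV1 (BondIdx)
open T3ContinuumYM3Torus (T3Family)
open Summit.QuantumFields.YangMills.Theorems.FlatCubeOpsText (Adm22 IsLevWeight)
open Summit.QuantumFields.YangMills.Theorems.Prop8Chart

variable {P : Params} {j : ℕ}
variable {𝔸 : Type*} [NormedRing 𝔸] [NormedAlgebra ℂ 𝔸] [CompleteSpace 𝔸]
variable {E : Type*} [NormedAddCommGroup E] [NormedSpace ℂ E]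

/-! ## §1 Local differentiability of the frames and of the double-bar one step -/

omit [NormedAlgebra ℂ 𝔸] [CompleteSpace 𝔸] in
/-- The stair transporters of a field within `s` of `1` inside the block `y`, `4ℓs < 1`, are within `1` of `1`. [cite: Balaban1985Averaging, (110) p.34] -/
theorem norm_stairHol_sub_one_lt_one [NormOneClass 𝔸] (hj : j + 1 ≤ P.m + P.K) {S : GaugeField P j 𝔸ˣ} (y : Site P (j + 1)) {s : ℝ} (hs0 : 0 ≤ s)
    (hℓs : 4 * (((P.d + 2) * P.L : ℕ) : ℝ) * s < 1)
    (hS : ∀ b : PBond P j, blockOf b.src = y → blockOf b.tgt = y → ‖((S b : 𝔸ˣ) : 𝔸) - 1‖ ≤ s) (i : Idx P) :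
    ‖((holT S (emb y) (stairWord i.2.1 (off i.1)) : 𝔸ˣ) : 𝔸) - 1‖ < 1 := by
  have hℓ1 : 1 ≤ (P.d + 2) * P.L := Nat.one_le_iff_ne_zero.mpr (Nat.mul_ne_zero (by omega) (by have := P.hL.2; omega))
  have hlen : (stairWord i.2.1 (off i.1) : List (Letter P.d)).length ≤ (P.d + 2) * P.L := by
    have h := length_walk_stairWord_le (emb y) i.2.1 i.1
    rwa [length_walk] at h
  have h := (norm_holT_sub_one_sub_walkSum_le_of_length_le hs0 hℓ1 hℓs.le _ _ hlen
    fun st hst => hS st.bond (blockOf_ends_of_mem_stairWalk hj y i.1 i.2.1 st hst).1 (blockOf_ends_of_mem_stairWalk hj y i.1 i.2.1 st hst).2).1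
  exact h.trans_lt hℓs

/-- **THE BLOCK FRAME IS DIFFERENTIABLE IN A PARAMETER** as soon as the bond variables inside the block are and the stair transporters at the base point are within `1`
of `1`. [cite: Balaban1985Averaging, (110) p.34] -/
theorem differentiableAt_coe_vframeU_of_block (hj : j + 1 ≤ P.m + P.K) {F : E → GaugeField P j 𝔸ˣ} {x₀ : E} (y : Site P (j + 1))
    (hF : ∀ b : PBond P j, blockOf b.src = y → blockOf b.tgt = y → DifferentiableAt ℂ (fun x => ((F x b : 𝔸ˣ) : 𝔸)) x₀)
    (hstair : ∀ i : Idx P, ‖((holT (F x₀) (emb y) (stairWord i.2.1 (off i.1)) : 𝔸ˣ) : 𝔸) - 1‖ < 1) :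
    DifferentiableAt ℂ (fun x => ((vframeU (F x) y : 𝔸ˣ) : 𝔸)) x₀ := by
  have h : (fun x => ((vframeU (F x) y : 𝔸ˣ) : 𝔸)) = fun x => eml (fun i : Idx P => ((holT (F x) (emb y) (stairWord i.2.1 (off i.1)) : 𝔸ˣ) : 𝔸)) := by
    funext x; exact coe_vframeU (F x) y
  rw [h]
  have hfam : DifferentiableAt ℂ (fun x => fun i : Idx P => ((holT (F x) (emb y) (stairWord i.2.1 (off i.1)) : 𝔸ˣ) : 𝔸)) x₀ :=
    differentiableAt_pi.mpr fun i => differentiableAt_coe_holT_of_steps _ _ fun st hst =>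
      hF st.bond (blockOf_ends_of_mem_stairWalk hj y i.1 i.2.1 st hst).1 (blockOf_ends_of_mem_stairWalk hj y i.1 i.2.1 st hst).2
  exact (differentiableAt_eml hstair).comp x₀ hfam

/-- **LOCAL DIFFERENTIABILITY OF THE DOUBLE-BAR ONE STEP** `x ↦ U̿(F x)(c) = v(c₋)⁻¹·Ū(c)·v(c₊)`: two-block bond variables differentiable, loop and stair variables at
`x₀` within `1` of `1`. [cite: Balaban1985Averaging, (89) p.31, (110) p.34; Balaban1987RG1, (0.4) p.253] -/
theorem differentiableAt_coe_dbarAvgU_of_twoBlock (hj : j + 1 ≤ P.m + P.K) {F : E → GaugeField P j 𝔸ˣ} {x₀ : E} (c : PBond P (j + 1))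
    (hF : ∀ b : PBond P j, (blockOf b.src = c.src ∨ blockOf b.src = c.tgt) → (blockOf b.tgt = c.src ∨ blockOf b.tgt = c.tgt) →
      DifferentiableAt ℂ (fun x => ((F x b : 𝔸ˣ) : 𝔸)) x₀)
    (hloop : ∀ i : Idx P, ‖((loopHolU (F x₀) c i : 𝔸ˣ) : 𝔸) - 1‖ < 1)
    (hstair : ∀ (y : Site P (j + 1)), (y = c.src ∨ y = c.tgt) → ∀ i : Idx P, ‖((holT (F x₀) (emb y) (stairWord i.2.1 (off i.1)) : 𝔸ˣ) : 𝔸) - 1‖ < 1) :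
    DifferentiableAt ℂ (fun x => ((dbarAvgU (F x) c : 𝔸ˣ) : 𝔸)) x₀ := by
  have h : (fun x => ((dbarAvgU (F x) c : 𝔸ˣ) : 𝔸)) =
      fun x => (((vframeU (F x) c.src)⁻¹ : 𝔸ˣ) : 𝔸) * ((emlAvgU (F x) c : 𝔸ˣ) : 𝔸) * ((vframeU (F x) c.tgt : 𝔸ˣ) : 𝔸) := by
    funext x; exact coe_dbarAvgU (F x) c
  rw [h]
  have hsrc : DifferentiableAt ℂ (fun x => ((vframeU (F x) c.src : 𝔸ˣ) : 𝔸)) x₀ :=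
    differentiableAt_coe_vframeU_of_block hj c.src (fun b h1 h2 => hF b (Or.inl h1) (Or.inl h2)) (hstair c.src (Or.inl rfl))
  have htgt : DifferentiableAt ℂ (fun x => ((vframeU (F x) c.tgt : 𝔸ˣ) : 𝔸)) x₀ :=
    differentiableAt_coe_vframeU_of_block hj c.tgt (fun b h1 h2 => hF b (Or.inr h1) (Or.inr h2)) (hstair c.tgt (Or.inr rfl))
  exact ((differentiableAt_coe_inv hsrc).mul (differentiableAt_coe_emlAvgU_of_twoBlock hj c hF hloop)).mul htgt

/-! ## §2 The iterated double-bar average is differentiable at near-flat base points of the read territory -/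

/-- **`A ↦ U̿^{(i)}(e^{iηA})(e)` IS ℂ-DIFFERENTIABLE AT EVERY `A₀` WHOSE CHARTED BOND VARIABLES ARE WITHIN `s₀` OF `1` UNDER `S ∋ e₋, e₊`, `8C₁ℓ²Lⁱs₀ ≤ 1`**
(`hstep` = brick B1's one-step ♭ letter). [cite: Balaban1985Variational, (156) p.302; Balaban1985Averaging, Prop. 4 p.38; Balaban1987RG1, (0.21) p.256] -/
theorem differentiableAt_coe_dbarIterU_of_reads [NormOneClass 𝔸] (η : ℝ) {C₁ : ℝ} (hC₁ : 2 ≤ C₁)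
    (hstep : ∀ (j : ℕ), j + 1 ≤ P.m + P.K → ∀ (S : GaugeField P j 𝔸ˣ) (c : PBond P (j + 1)) (s : ℝ), 0 ≤ s →
      48 * (((P.d + 2) * P.L : ℕ) : ℝ) * s ≤ 1 →
      (∀ b : PBond P j, (blockOf b.src = c.src ∨ blockOf b.src = c.tgt) → (blockOf b.tgt = c.src ∨ blockOf b.tgt = c.tgt) →
        ‖((S b : 𝔸ˣ) : 𝔸) - 1‖ ≤ s) →
      ‖((dbarAvgU S c : 𝔸ˣ) : 𝔸) - 1‖ ≤ (P.L : ℝ) * s + C₁ * (((P.d + 2) * P.L : ℕ) : ℝ) ^ 2 * s ^ 2) :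
    ∀ (i : ℕ), i ≤ P.m + P.K → ∀ (S : Set (Site P i)) (A₀ : PBond P 0 → 𝔸) (s₀ : ℝ), 0 ≤ s₀ →
      8 * C₁ * (((P.d + 2) * P.L : ℕ) : ℝ) ^ 2 * (P.L : ℝ) ^ i * s₀ ≤ 1 →
      (∀ b : PBond P 0, iterBlockOf i b.src ∈ S → iterBlockOf i b.tgt ∈ S → ‖((expCfg η A₀ b : 𝔸ˣ) : 𝔸) - 1‖ ≤ s₀) →
      ∀ e : PBond P i, e.src ∈ S → e.tgt ∈ S →
        DifferentiableAt ℂ (fun A : PBond P 0 → 𝔸 => ((dbarIterU i (expCfg η A) e : 𝔸ˣ) : 𝔸)) A₀ := by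
  set ℓ : ℝ := (((P.d + 2) * P.L : ℕ) : ℝ) with hℓ
  have hℓ1 : (1 : ℝ) ≤ ℓ := by
    rw [hℓ]; exact_mod_cast Nat.one_le_iff_ne_zero.mpr (Nat.mul_ne_zero (by omega) (by have := P.hL.2; omega))
  have hℓ0 : (0 : ℝ) ≤ ℓ := by linarith
  have hL1 : (1 : ℝ) ≤ P.L := by exact_mod_cast P.L_pos
  have hC₁0 : (0 : ℝ) ≤ C₁ := by linarith
  intro i
  induction i with
  | zero =>
    intro _ S A₀ s₀ _ _ _ e _ _
    simpa only [dbarIterU_zero] using differentiableAt_coe_expCfg (P := P) (𝔸 := 𝔸) η e A₀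
  | succ i ih =>
    intro hi S A₀ s₀ hs₀ hbudget hA c hcs hct
    have hbudget_i : 8 * C₁ * ℓ ^ 2 * (P.L : ℝ) ^ i * s₀ ≤ 1 := by
      refine le_trans ?_ hbudget
      have : (P.L : ℝ) ^ i ≤ (P.L : ℝ) ^ (i + 1) := pow_le_pow_right₀ hL1 (Nat.le_succ i)
      have h0 : 0 ≤ 8 * C₁ * ℓ ^ 2 * s₀ := by positivity
      nlinarith
    set S' : Set (Site P i) := {y | blockOf y ∈ S} with hS'
    have hA' : ∀ b : PBond P 0, iterBlockOf i b.src ∈ S' → iterBlockOf i b.tgt ∈ S' → ‖((expCfg η A₀ b : 𝔸ˣ) : 𝔸) - 1‖ ≤ s₀ :=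
      fun b hs ht => hA b (by rw [iterBlockOf_succ]; exact hs) (by rw [iterBlockOf_succ]; exact ht)
    have hF : ∀ e : PBond P i, e.src ∈ S' → e.tgt ∈ S' →
        DifferentiableAt ℂ (fun A : PBond P 0 → 𝔸 => ((dbarIterU i (expCfg η A) e : 𝔸ˣ) : 𝔸)) A₀ :=
      ih (Nat.le_of_succ_le hi) S' A₀ s₀ hs₀ hbudget_i hA'
    -- near-flatness of the level-`i` double-bar field under `S` (part 1)
    have hnear : ∀ e : PBond P i, e.src ∈ S' → e.tgt ∈ S' →
        ‖((dbarIterU i (expCfg η A₀) e : 𝔸ˣ) : 𝔸) - 1‖ ≤ 2 * ((P.L : ℝ) ^ i * s₀) :=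
      fun e hs ht => norm_dbarIterU_sub_one_le_two_mul hC₁ hstep (Nat.le_of_succ_le hi) S' (expCfg η A₀) hs₀ hbudget_i hA' e hs ht
    have hfun : (fun A : PBond P 0 → 𝔸 => ((dbarIterU (i + 1) (expCfg η A) c : 𝔸ˣ) : 𝔸)) =
        fun A => ((dbarAvgU (dbarIterU i (expCfg η A)) c : 𝔸ˣ) : 𝔸) := by
      funext A; rw [dbarIterU_succ]
    rw [hfun]
    have hmem : ∀ b : PBond P i, (blockOf b.src = c.src ∨ blockOf b.src = c.tgt) → (blockOf b.tgt = c.src ∨ blockOf b.tgt = c.tgt) →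
        b.src ∈ S' ∧ b.tgt ∈ S' := by
      intro b hbs hbt
      constructor
      · show blockOf b.src ∈ S
        rcases hbs with h | h <;> rw [h]
        exacts [hcs, hct]
      · show blockOf b.tgt ∈ S
        rcases hbt with h | h <;> rw [h]
        exacts [hcs, hct]
    -- the smallness `4ℓ·(2Lⁱs₀) < 1` of the loop and stair variables
    have h2x : 0 ≤ 2 * ((P.L : ℝ) ^ i * s₀) := by positivity
    have hlt : 4 * (((P.d + 2) * P.L : ℕ) : ℝ) * (2 * ((P.L : ℝ) ^ i * s₀)) < 1 := by
      rw [← hℓ]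
      have hx0 : 0 ≤ (P.L : ℝ) ^ i * s₀ := by positivity
      have h16 : 8 * ℓ * ((P.L : ℝ) ^ i * s₀) ≤ 8 * C₁ * ℓ ^ 2 * ((P.L : ℝ) ^ i * s₀) / 2 := by
        have : 2 * (8 * ℓ) ≤ 8 * C₁ * ℓ ^ 2 := by nlinarith [mul_le_mul hC₁ hℓ1 zero_le_one hC₁0]
        nlinarith
      have hb' : 8 * C₁ * ℓ ^ 2 * ((P.L : ℝ) ^ i * s₀) ≤ 1 := by
        have : 8 * C₁ * ℓ ^ 2 * ((P.L : ℝ) ^ i * s₀) = 8 * C₁ * ℓ ^ 2 * (P.L : ℝ) ^ i * s₀ := by ring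
        rw [this]; exact hbudget_i
      nlinarith
    refine differentiableAt_coe_dbarAvgU_of_twoBlock (F := fun A : PBond P 0 → 𝔸 => dbarIterU i (expCfg η A)) hi c
      (fun b hbs hbt => hF b (hmem b hbs hbt).1 (hmem b hbs hbt).2) ?_ ?_
    · exact norm_loopHolU_sub_one_lt_one hi c h2x hlt fun b hbs hbt => hnear b (hmem b hbs hbt).1 (hmem b hbs hbt).2
    · intro y hy idx
      refine norm_stairHol_sub_one_lt_one hi y h2x hlt (fun b h1 h2 => hnear b ?_ ?_) idx
      · show blockOf b.src ∈ S
        rw [h1]; rcases hy with h | h <;> rw [h]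
        exacts [hcs, hct]
      · show blockOf b.tgt ∈ S
        rw [h2]; rcases hy with h | h <;> rw [h]
        exacts [hcs, hct]

/-! ## §3 At an index bond: differentiability and the sup letter -/

/-- **AT AN INDEX `(j, c)`**: under the read-set smallness `8C₁ℓ²Lʲs₀ ≤ 1`, `A ↦ chartLogFlat η D A (j,c)` is ℂ-differentiable at `A₀` and
`‖U̿^{(j)}(e^{iηA₀})(c) − 1‖ ≤ 2·Lʲs₀`. [cite: Balaban1985Variational, (20) p.281, (156) p.302] -/
theorem differentiableAt_chartLogFlat_apply_of_reads [NormOneClass 𝔸] (η : ℝ) {C₁ : ℝ} (hC₁ : 2 ≤ C₁)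
    (hstep : ∀ (j : ℕ), j + 1 ≤ P.m + P.K → ∀ (S : GaugeField P j 𝔸ˣ) (c : PBond P (j + 1)) (s : ℝ), 0 ≤ s →
      48 * (((P.d + 2) * P.L : ℕ) : ℝ) * s ≤ 1 →
      (∀ b : PBond P j, (blockOf b.src = c.src ∨ blockOf b.src = c.tgt) → (blockOf b.tgt = c.src ∨ blockOf b.tgt = c.tgt) →
        ‖((S b : 𝔸ˣ) : 𝔸) - 1‖ ≤ s) →
      ‖((dbarAvgU S c : 𝔸ˣ) : 𝔸) - 1‖ ≤ (P.L : ℝ) * s + C₁ * (((P.d + 2) * P.L : ℕ) : ℝ) ^ 2 * s ^ 2)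
    (D : Domains P) (idx : BondIdx D) (A₀ : PBond P 0 → 𝔸) {s₀ : ℝ} (hs₀ : 0 ≤ s₀)
    (hbudget : 8 * C₁ * (((P.d + 2) * P.L : ℕ) : ℝ) ^ 2 * (P.L : ℝ) ^ (idx.1.1 : ℕ) * s₀ ≤ 1)
    (hA : ∀ b : PBond P 0, (iterBlockOf (idx.1.1 : ℕ) b.src = idx.1.2.src ∨ iterBlockOf (idx.1.1 : ℕ) b.src = idx.1.2.tgt) →
      (iterBlockOf (idx.1.1 : ℕ) b.tgt = idx.1.2.src ∨ iterBlockOf (idx.1.1 : ℕ) b.tgt = idx.1.2.tgt) → ‖((expCfg η A₀ b : 𝔸ˣ) : 𝔸) - 1‖ ≤ s₀) :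
    DifferentiableAt ℂ (fun A : PBond P 0 → 𝔸 => chartLogFlat η D A idx) A₀ ∧
      ‖((dbarIterU (idx.1.1 : ℕ) (expCfg η A₀) idx.1.2 : 𝔸ˣ) : 𝔸) - 1‖ ≤ 2 * ((P.L : ℝ) ^ (idx.1.1 : ℕ) * s₀) := by
  have hj : (idx.1.1 : ℕ) ≤ P.m + P.K := (Nat.lt_succ_iff.mp idx.1.1.isLt).trans D.hk
  set S : Set (Site P (idx.1.1 : ℕ)) := {y | y = idx.1.2.src ∨ y = idx.1.2.tgt} with hS
  have hA' : ∀ b : PBond P 0, iterBlockOf (idx.1.1 : ℕ) b.src ∈ S → iterBlockOf (idx.1.1 : ℕ) b.tgt ∈ S →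
      ‖((expCfg η A₀ b : 𝔸ˣ) : 𝔸) - 1‖ ≤ s₀ := fun b hs ht => hA b hs ht
  have hnear := norm_dbarIterU_sub_one_le_two_mul hC₁ hstep hj S (expCfg η A₀) hs₀ hbudget hA' idx.1.2 (Or.inl rfl) (Or.inr rfl)
  have hdiff := differentiableAt_coe_dbarIterU_of_reads η hC₁ hstep (idx.1.1 : ℕ) hj S A₀ s₀ hs₀ hbudget hA' idx.1.2 (Or.inl rfl) (Or.inr rfl)
  refine ⟨?_, hnear⟩
  have hℓ1 : (1 : ℝ) ≤ (((P.d + 2) * P.L : ℕ) : ℝ) := by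
    exact_mod_cast Nat.one_le_iff_ne_zero.mpr (Nat.mul_ne_zero (by omega) (by have := P.hL.2; omega))
  have hlt1 : ‖((dbarIterU (idx.1.1 : ℕ) (expCfg η A₀) idx.1.2 : 𝔸ˣ) : 𝔸) - 1‖ < 1 := by
    refine hnear.trans_lt ?_
    have h0 : 0 ≤ (P.L : ℝ) ^ (idx.1.1 : ℕ) * s₀ := by positivity
    have h1 : 8 * C₁ * (((P.d + 2) * P.L : ℕ) : ℝ) ^ 2 * ((P.L : ℝ) ^ (idx.1.1 : ℕ) * s₀) ≤ 1 := by
      have : 8 * C₁ * (((P.d + 2) * P.L : ℕ) : ℝ) ^ 2 * ((P.L : ℝ) ^ (idx.1.1 : ℕ) * s₀) =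
          8 * C₁ * (((P.d + 2) * P.L : ℕ) : ℝ) ^ 2 * (P.L : ℝ) ^ (idx.1.1 : ℕ) * s₀ := by ring
      rw [this]; exact hbudget
    nlinarith [mul_le_mul hC₁ (one_le_pow₀ (M₀ := ℝ) hℓ1 : (1:ℝ) ≤ _ ^ 2) zero_le_one (by linarith)]
  have hfun : (fun A : PBond P 0 → 𝔸 => chartLogFlat η D A idx) =
      fun A => (-Complex.I) • mlog (((dbarIterU (idx.1.1 : ℕ) (expCfg η A)) idx.1.2 : 𝔸ˣ) : 𝔸) := rfl
  rw [hfun]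
  exact ((MatrixLog.analyticAt_mlog hlt1).differentiableAt.comp A₀ hdiff).const_smul (-Complex.I)

/-- **THE SUP LETTER AT AN INDEX**: under the same hypotheses `‖chartLogFlat η D A₀ (j,c)‖ ≤ 4·Lʲ·s₀` (`|log X| ≤ 2|X − 1|` for `|X − 1| ≤ ½`).
[cite: Balaban1985Variational, (20) p.281, (44) p.285; Balaban1985Averaging, (26) p.22] -/
theorem norm_chartLogFlat_apply_le_of_reads [NormOneClass 𝔸] (η : ℝ) {C₁ : ℝ} (hC₁ : 2 ≤ C₁)
    (hstep : ∀ (j : ℕ), j + 1 ≤ P.m + P.K → ∀ (S : GaugeField P j 𝔸ˣ) (c : PBond P (j + 1)) (s : ℝ), 0 ≤ s →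
      48 * (((P.d + 2) * P.L : ℕ) : ℝ) * s ≤ 1 →
      (∀ b : PBond P j, (blockOf b.src = c.src ∨ blockOf b.src = c.tgt) → (blockOf b.tgt = c.src ∨ blockOf b.tgt = c.tgt) →
        ‖((S b : 𝔸ˣ) : 𝔸) - 1‖ ≤ s) →
      ‖((dbarAvgU S c : 𝔸ˣ) : 𝔸) - 1‖ ≤ (P.L : ℝ) * s + C₁ * (((P.d + 2) * P.L : ℕ) : ℝ) ^ 2 * s ^ 2)
    (D : Domains P) (idx : BondIdx D) (A₀ : PBond P 0 → 𝔸) {s₀ : ℝ} (hs₀ : 0 ≤ s₀)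
    (hbudget : 8 * C₁ * (((P.d + 2) * P.L : ℕ) : ℝ) ^ 2 * (P.L : ℝ) ^ (idx.1.1 : ℕ) * s₀ ≤ 1)
    (hA : ∀ b : PBond P 0, (iterBlockOf (idx.1.1 : ℕ) b.src = idx.1.2.src ∨ iterBlockOf (idx.1.1 : ℕ) b.src = idx.1.2.tgt) →
      (iterBlockOf (idx.1.1 : ℕ) b.tgt = idx.1.2.src ∨ iterBlockOf (idx.1.1 : ℕ) b.tgt = idx.1.2.tgt) → ‖((expCfg η A₀ b : 𝔸ˣ) : 𝔸) - 1‖ ≤ s₀) :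
    ‖chartLogFlat η D A₀ idx‖ ≤ 4 * ((P.L : ℝ) ^ (idx.1.1 : ℕ) * s₀) := by
  obtain ⟨-, hnear⟩ := differentiableAt_chartLogFlat_apply_of_reads η hC₁ hstep D idx A₀ hs₀ hbudget hA
  have hℓ1 : (1 : ℝ) ≤ (((P.d + 2) * P.L : ℕ) : ℝ) := by
    exact_mod_cast Nat.one_le_iff_ne_zero.mpr (Nat.mul_ne_zero (by omega) (by have := P.hL.2; omega))
  have hhalf : ‖((dbarIterU (idx.1.1 : ℕ) (expCfg η A₀) idx.1.2 : 𝔸ˣ) : 𝔸) - 1‖ ≤ 1 / 2 := by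
    refine hnear.trans ?_
    have h0 : 0 ≤ (P.L : ℝ) ^ (idx.1.1 : ℕ) * s₀ := by positivity
    have h1 : 8 * C₁ * (((P.d + 2) * P.L : ℕ) : ℝ) ^ 2 * ((P.L : ℝ) ^ (idx.1.1 : ℕ) * s₀) ≤ 1 := by
      have : 8 * C₁ * (((P.d + 2) * P.L : ℕ) : ℝ) ^ 2 * ((P.L : ℝ) ^ (idx.1.1 : ℕ) * s₀) =
          8 * C₁ * (((P.d + 2) * P.L : ℕ) : ℝ) ^ 2 * (P.L : ℝ) ^ (idx.1.1 : ℕ) * s₀ := by ring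
      rw [this]; exact hbudget
    nlinarith [mul_le_mul hC₁ (one_le_pow₀ (M₀ := ℝ) hℓ1 : (1:ℝ) ≤ _ ^ 2) zero_le_one (by linarith)]
  rw [chartLogFlat_apply, norm_smul, norm_neg, Complex.norm_I, one_mul]
  exact (norm_mlog_le_two_mul hhalf).trans (by linarith)

/-! ## §4 hCd♭ on the weighted ball of the F4 pen, k-uniform radius, and the k-uniform sup letter -/

section Weighted

open scoped Matrix.Norms.L2Operator

/-- On the weighted ball of radius `R`, `L·R ≤ 1`, the charted bond variables read by a level-`j` index are within `2·L·R·L^{−j}` of `1`.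
[cite: Balaban1985Variational, (152) p.301] -/
theorem norm_expCfg_sub_one_le_of_weightedBall_flat (F : T3Family) (n K : ℕ) (D : Domains (F.P K)) (hDk : D.k = K - n)
    (hcollar : ∀ (i : ℕ) (e : PBond (F.P K) (i + 1)), D.LamBond (i + 1) e → ∀ z : Site (F.P K) i, (blockOf z = e.src ∨ blockOf z = e.tgt) → z ∈ D.Om i)
    {w : ℕ → PBond (F.P K) 0 → ℝ} (hw : IsLevWeight F n K D w) {R : ℝ} (hLR : (F.L : ℝ) * R ≤ 1)
    {A : PBond (F.P K) 0 → Matrix (Fin 2) (Fin 2) ℂ} (hA : ∀ b, w 1 b * ‖A b‖ < R) (idx : BondIdx D) (b : PBond (F.P K) 0)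
    (hb : iterBlockOf (idx.1.1 : ℕ) b.src = idx.1.2.src ∨ iterBlockOf (idx.1.1 : ℕ) b.src = idx.1.2.tgt) :
    ‖((expCfg (((F.L : ℝ)⁻¹) ^ (K - n)) A b : (Matrix (Fin 2) (Fin 2) ℂ)ˣ) : Matrix (Fin 2) (Fin 2) ℂ) - 1‖ ≤
      2 * (F.L : ℝ) * R * ((F.L : ℝ) ^ (idx.1.1 : ℕ))⁻¹ := by
  have hL1 : (1 : ℝ) ≤ F.L := by exact_mod_cast (F.P K).L_pos
  have hL0 : (0 : ℝ) < F.L := by linarith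
  have hLj : 0 < (F.L : ℝ) ^ (idx.1.1 : ℕ) := by positivity
  have hread := weighted_read_bound F n K D hDk hcollar hw hA idx b hb
  set η : ℝ := ((F.L : ℝ)⁻¹) ^ (K - n) with hη
  have hη0 : 0 ≤ η := by positivity
  have hηA : η * ‖A b‖ ≤ (F.L : ℝ) * R * ((F.L : ℝ) ^ (idx.1.1 : ℕ))⁻¹ := by
    rw [le_mul_inv_iff₀ hLj]
    calc η * ‖A b‖ * (F.L : ℝ) ^ (idx.1.1 : ℕ) = η * (F.L : ℝ) ^ (idx.1.1 : ℕ) * ‖A b‖ := by ring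
      _ ≤ (F.L : ℝ) * R := hread.le
  have hsmall : ‖((η : ℝ) : ℂ) • A b‖ ≤ 1 := by
    rw [norm_smul, Complex.norm_real, Real.norm_eq_abs, abs_of_nonneg hη0]
    refine hηA.trans ?_
    calc (F.L : ℝ) * R * ((F.L : ℝ) ^ (idx.1.1 : ℕ))⁻¹ ≤ 1 * ((F.L : ℝ) ^ (idx.1.1 : ℕ))⁻¹ := by gcongr
      _ ≤ 1 := by rw [one_mul]; exact inv_le_one_of_one_le₀ (one_le_pow₀ hL1)
  calc _ ≤ 2 * ‖((η : ℝ) : ℂ) • A b‖ := norm_coe_expCfg_sub_one_le η A b hsmall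
    _ = 2 * (η * ‖A b‖) := by rw [norm_smul, Complex.norm_real, Real.norm_eq_abs, abs_of_nonneg hη0]
    _ ≤ 2 * ((F.L : ℝ) * R * ((F.L : ℝ) ^ (idx.1.1 : ℕ))⁻¹) := by gcongr
    _ = 2 * (F.L : ℝ) * R * ((F.L : ℝ) ^ (idx.1.1 : ℕ))⁻¹ := by ring

/-- **hCd♭: THE DOUBLE-BAR CONSTRAINT MAP IS ℂ-DIFFERENTIABLE ON THE WEIGHTED SUP-BALL, k-UNIFORM RADIUS `16·C₁·ℓ²·L·R ≤ 1`** (`η = L^{−(K−n)}`, level weights `w`,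
collar property; `hstep` = brick B1). [cite: Balaban1985Variational, (20) p.281, (44)-(48) p.285, (156)-(157) p.302; Balaban1985Averaging, Prop. 4 p.38] -/
theorem differentiableOn_chartLogFlat_weightedBall (F : T3Family) (n K : ℕ) (D : Domains (F.P K)) (hDk : D.k = K - n)
    (hcollar : ∀ (i : ℕ) (e : PBond (F.P K) (i + 1)), D.LamBond (i + 1) e → ∀ z : Site (F.P K) i, (blockOf z = e.src ∨ blockOf z = e.tgt) → z ∈ D.Om i)
    {w : ℕ → PBond (F.P K) 0 → ℝ} (hw : IsLevWeight F n K D w) {C₁ : ℝ} (hC₁ : 2 ≤ C₁)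
    (hstep : ∀ (j : ℕ), j + 1 ≤ (F.P K).m + (F.P K).K → ∀ (S : GaugeField (F.P K) j (Matrix (Fin 2) (Fin 2) ℂ)ˣ) (c : PBond (F.P K) (j + 1)) (s : ℝ), 0 ≤ s →
      48 * ((((F.P K).d + 2) * (F.P K).L : ℕ) : ℝ) * s ≤ 1 →
      (∀ b : PBond (F.P K) j, (blockOf b.src = c.src ∨ blockOf b.src = c.tgt) → (blockOf b.tgt = c.src ∨ blockOf b.tgt = c.tgt) →
        ‖((S b : (Matrix (Fin 2) (Fin 2) ℂ)ˣ) : Matrix (Fin 2) (Fin 2) ℂ) - 1‖ ≤ s) →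
      ‖((dbarAvgU S c : (Matrix (Fin 2) (Fin 2) ℂ)ˣ) : Matrix (Fin 2) (Fin 2) ℂ) - 1‖ ≤ ((F.P K).L : ℝ) * s + C₁ * ((((F.P K).d + 2) * (F.P K).L : ℕ) : ℝ) ^ 2 * s ^ 2)
    {R : ℝ} (hR : 16 * C₁ * ((((F.P K).d + 2) * (F.P K).L : ℕ) : ℝ) ^ 2 * (F.L : ℝ) * R ≤ 1) :
    DifferentiableOn ℂ
      (chartLogFlat (((F.L : ℝ)⁻¹) ^ (K - n)) D :
        (PBond (F.P K) 0 → Matrix (Fin 2) (Fin 2) ℂ) → BondIdx D → Matrix (Fin 2) (Fin 2) ℂ)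
      {Y | ∀ b, w 1 b * ‖Y b‖ < R} := by
  have hL1 : (1 : ℝ) ≤ F.L := by exact_mod_cast (F.P K).L_pos
  have hL0 : (0 : ℝ) < F.L := by linarith
  have hℓ1 : (1 : ℝ) ≤ ((((F.P K).d + 2) * (F.P K).L : ℕ) : ℝ) := by
    exact_mod_cast Nat.one_le_iff_ne_zero.mpr (Nat.mul_ne_zero (by omega) (by have := (F.P K).hL.2; omega))
  have hC₁0 : (0 : ℝ) ≤ C₁ := by linarith
  intro A₀ hA₀
  refine (differentiableAt_pi.mpr fun idx => ?_).differentiableWithinAt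
  have hLj : 0 < (F.L : ℝ) ^ (idx.1.1 : ℕ) := by positivity
  have hR0 : 0 ≤ R := by
    have := hA₀ (⟨fun _ => 0, idx.1.2.dir⟩ : PBond (F.P K) 0)
    have hw0 : 0 ≤ w 1 ⟨fun _ => 0, idx.1.2.dir⟩ * ‖A₀ ⟨fun _ => 0, idx.1.2.dir⟩‖ := by
      rw [hw 1, pow_one]; exact mul_nonneg (by positivity) (norm_nonneg _)
    linarith
  have hLR : (F.L : ℝ) * R ≤ 1 := by
    have h16 : (1 : ℝ) ≤ 16 * C₁ * ((((F.P K).d + 2) * (F.P K).L : ℕ) : ℝ) ^ 2 := by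
      nlinarith [mul_le_mul hC₁ (one_le_pow₀ (M₀ := ℝ) hℓ1 : (1:ℝ) ≤ _ ^ 2) zero_le_one hC₁0]
    nlinarith [mul_nonneg hL0.le hR0]
  set s₀ : ℝ := 2 * (F.L : ℝ) * R * ((F.L : ℝ) ^ (idx.1.1 : ℕ))⁻¹ with hs₀
  have hs₀0 : 0 ≤ s₀ := by positivity
  have hbudget : 8 * C₁ * ((((F.P K).d + 2) * (F.P K).L : ℕ) : ℝ) ^ 2 * (F.L : ℝ) ^ (idx.1.1 : ℕ) * s₀ ≤ 1 := by
    have : 8 * C₁ * ((((F.P K).d + 2) * (F.P K).L : ℕ) : ℝ) ^ 2 * (F.L : ℝ) ^ (idx.1.1 : ℕ) * s₀ =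
        16 * C₁ * ((((F.P K).d + 2) * (F.P K).L : ℕ) : ℝ) ^ 2 * (F.L : ℝ) * R := by
      rw [hs₀]; field_simp; ring
    rw [this]; exact hR
  have hA : ∀ b : PBond (F.P K) 0, (iterBlockOf (idx.1.1 : ℕ) b.src = idx.1.2.src ∨ iterBlockOf (idx.1.1 : ℕ) b.src = idx.1.2.tgt) →
      (iterBlockOf (idx.1.1 : ℕ) b.tgt = idx.1.2.src ∨ iterBlockOf (idx.1.1 : ℕ) b.tgt = idx.1.2.tgt) →
      ‖((expCfg (((F.L : ℝ)⁻¹) ^ (K - n)) A₀ b : (Matrix (Fin 2) (Fin 2) ℂ)ˣ) : Matrix (Fin 2) (Fin 2) ℂ) - 1‖ ≤ s₀ :=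
    fun b hb _ => norm_expCfg_sub_one_le_of_weightedBall_flat F n K D hDk hcollar hw hLR hA₀ idx b hb
  have hLF : ((F.P K).L : ℝ) = F.L := by norm_cast
  exact (differentiableAt_chartLogFlat_apply_of_reads _ hC₁ hstep D idx A₀ hs₀0 (by rw [hLF]; exact hbudget) (by exact hA)).1

/-- **THE k-UNIFORM SUP LETTER ON THE WEIGHTED BALL**: `‖chartLogFlat η D A (j,c)‖ ≤ 8·L·R` at every index, for every `A` in the weighted ball of radius `R`,
`16·C₁·ℓ²·L·R ≤ 1` — the bound brick B3's Cauchy estimate starts from; no comb factor. [cite: Balaban1985Variational, (20) p.281, (44)-(47) p.285] -/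
theorem norm_chartLogFlat_le_weightedBall (F : T3Family) (n K : ℕ) (D : Domains (F.P K)) (hDk : D.k = K - n)
    (hcollar : ∀ (i : ℕ) (e : PBond (F.P K) (i + 1)), D.LamBond (i + 1) e → ∀ z : Site (F.P K) i, (blockOf z = e.src ∨ blockOf z = e.tgt) → z ∈ D.Om i)
    {w : ℕ → PBond (F.P K) 0 → ℝ} (hw : IsLevWeight F n K D w) {C₁ : ℝ} (hC₁ : 2 ≤ C₁)
    (hstep : ∀ (j : ℕ), j + 1 ≤ (F.P K).m + (F.P K).K → ∀ (S : GaugeField (F.P K) j (Matrix (Fin 2) (Fin 2) ℂ)ˣ) (c : PBond (F.P K) (j + 1)) (s : ℝ), 0 ≤ s →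
      48 * ((((F.P K).d + 2) * (F.P K).L : ℕ) : ℝ) * s ≤ 1 →
      (∀ b : PBond (F.P K) j, (blockOf b.src = c.src ∨ blockOf b.src = c.tgt) → (blockOf b.tgt = c.src ∨ blockOf b.tgt = c.tgt) →
        ‖((S b : (Matrix (Fin 2) (Fin 2) ℂ)ˣ) : Matrix (Fin 2) (Fin 2) ℂ) - 1‖ ≤ s) →
      ‖((dbarAvgU S c : (Matrix (Fin 2) (Fin 2) ℂ)ˣ) : Matrix (Fin 2) (Fin 2) ℂ) - 1‖ ≤ ((F.P K).L : ℝ) * s + C₁ * ((((F.P K).d + 2) * (F.P K).L : ℕ) : ℝ) ^ 2 * s ^ 2)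
    {R : ℝ} (hR : 16 * C₁ * ((((F.P K).d + 2) * (F.P K).L : ℕ) : ℝ) ^ 2 * (F.L : ℝ) * R ≤ 1)
    {A : PBond (F.P K) 0 → Matrix (Fin 2) (Fin 2) ℂ} (hA : ∀ b, w 1 b * ‖A b‖ < R) (idx : BondIdx D) :
    ‖chartLogFlat (((F.L : ℝ)⁻¹) ^ (K - n)) D A idx‖ ≤ 8 * (F.L : ℝ) * R := by
  have hL1 : (1 : ℝ) ≤ F.L := by exact_mod_cast (F.P K).L_pos
  have hL0 : (0 : ℝ) < F.L := by linarith
  have hℓ1 : (1 : ℝ) ≤ ((((F.P K).d + 2) * (F.P K).L : ℕ) : ℝ) := by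
    exact_mod_cast Nat.one_le_iff_ne_zero.mpr (Nat.mul_ne_zero (by omega) (by have := (F.P K).hL.2; omega))
  have hC₁0 : (0 : ℝ) ≤ C₁ := by linarith
  have hLj : 0 < (F.L : ℝ) ^ (idx.1.1 : ℕ) := by positivity
  have hR0 : 0 ≤ R := by
    have := hA (⟨fun _ => 0, idx.1.2.dir⟩ : PBond (F.P K) 0)
    have hw0 : 0 ≤ w 1 ⟨fun _ => 0, idx.1.2.dir⟩ * ‖A ⟨fun _ => 0, idx.1.2.dir⟩‖ := by
      rw [hw 1, pow_one]; exact mul_nonneg (by positivity) (norm_nonneg _)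
    linarith
  have hLR : (F.L : ℝ) * R ≤ 1 := by
    have h16 : (1 : ℝ) ≤ 16 * C₁ * ((((F.P K).d + 2) * (F.P K).L : ℕ) : ℝ) ^ 2 := by
      nlinarith [mul_le_mul hC₁ (one_le_pow₀ (M₀ := ℝ) hℓ1 : (1:ℝ) ≤ _ ^ 2) zero_le_one hC₁0]
    nlinarith [mul_nonneg hL0.le hR0]
  set s₀ : ℝ := 2 * (F.L : ℝ) * R * ((F.L : ℝ) ^ (idx.1.1 : ℕ))⁻¹ with hs₀
  have hs₀0 : 0 ≤ s₀ := by positivity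
  have hbudget : 8 * C₁ * ((((F.P K).d + 2) * (F.P K).L : ℕ) : ℝ) ^ 2 * (F.L : ℝ) ^ (idx.1.1 : ℕ) * s₀ ≤ 1 := by
    have : 8 * C₁ * ((((F.P K).d + 2) * (F.P K).L : ℕ) : ℝ) ^ 2 * (F.L : ℝ) ^ (idx.1.1 : ℕ) * s₀ =
        16 * C₁ * ((((F.P K).d + 2) * (F.P K).L : ℕ) : ℝ) ^ 2 * (F.L : ℝ) * R := by
      rw [hs₀]; field_simp; ring
    rw [this]; exact hR
  have hA' : ∀ b : PBond (F.P K) 0, (iterBlockOf (idx.1.1 : ℕ) b.src = idx.1.2.src ∨ iterBlockOf (idx.1.1 : ℕ) b.src = idx.1.2.tgt) →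
      (iterBlockOf (idx.1.1 : ℕ) b.tgt = idx.1.2.src ∨ iterBlockOf (idx.1.1 : ℕ) b.tgt = idx.1.2.tgt) →
      ‖((expCfg (((F.L : ℝ)⁻¹) ^ (K - n)) A b : (Matrix (Fin 2) (Fin 2) ℂ)ˣ) : Matrix (Fin 2) (Fin 2) ℂ) - 1‖ ≤ s₀ :=
    fun b hb _ => norm_expCfg_sub_one_le_of_weightedBall_flat F n K D hDk hcollar hw hLR hA idx b hb
  have hLF : ((F.P K).L : ℝ) = F.L := by norm_cast
  have h := norm_chartLogFlat_apply_le_of_reads (((F.L : ℝ)⁻¹) ^ (K - n)) hC₁ hstep D idx A hs₀0 (by rw [hLF]; exact hbudget) hA'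
  rw [hLF] at h
  calc _ ≤ 4 * ((F.L : ℝ) ^ (idx.1.1 : ℕ) * s₀) := h
    _ = 8 * (F.L : ℝ) * R := by rw [hs₀]; field_simp; ring

/-- Both statements with the collar property discharged from (2.2)-admissibility, `2L ≤ R′·M + 1` (✓`collar_of_adm22`). [cite: Balaban1985Variational, (44)-(48) p.285; Balaban1984PropagatorsII, (2.2) p.224] -/
theorem differentiableOn_chartLogFlat_weightedBall_of_adm22 (F : T3Family) (n K : ℕ) (D : Domains (F.P K)) (hDk : D.k = K - n) {R' M : ℕ}
    (hAdm : Adm22 D R' M) (hRM : 2 * (F.P K).L ≤ R' * M + 1)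
    {w : ℕ → PBond (F.P K) 0 → ℝ} (hw : IsLevWeight F n K D w) {C₁ : ℝ} (hC₁ : 2 ≤ C₁)
    (hstep : ∀ (j : ℕ), j + 1 ≤ (F.P K).m + (F.P K).K → ∀ (S : GaugeField (F.P K) j (Matrix (Fin 2) (Fin 2) ℂ)ˣ) (c : PBond (F.P K) (j + 1)) (s : ℝ), 0 ≤ s →
      48 * ((((F.P K).d + 2) * (F.P K).L : ℕ) : ℝ) * s ≤ 1 →
      (∀ b : PBond (F.P K) j, (blockOf b.src = c.src ∨ blockOf b.src = c.tgt) → (blockOf b.tgt = c.src ∨ blockOf b.tgt = c.tgt) →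
        ‖((S b : (Matrix (Fin 2) (Fin 2) ℂ)ˣ) : Matrix (Fin 2) (Fin 2) ℂ) - 1‖ ≤ s) →
      ‖((dbarAvgU S c : (Matrix (Fin 2) (Fin 2) ℂ)ˣ) : Matrix (Fin 2) (Fin 2) ℂ) - 1‖ ≤ ((F.P K).L : ℝ) * s + C₁ * ((((F.P K).d + 2) * (F.P K).L : ℕ) : ℝ) ^ 2 * s ^ 2)
    {R : ℝ} (hR : 16 * C₁ * ((((F.P K).d + 2) * (F.P K).L : ℕ) : ℝ) ^ 2 * (F.L : ℝ) * R ≤ 1) :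
    DifferentiableOn ℂ
      (chartLogFlat (((F.L : ℝ)⁻¹) ^ (K - n)) D :
        (PBond (F.P K) 0 → Matrix (Fin 2) (Fin 2) ℂ) → BondIdx D → Matrix (Fin 2) (Fin 2) ℂ)
      {Y | ∀ b, w 1 b * ‖Y b‖ < R} ∧
    ∀ {A : PBond (F.P K) 0 → Matrix (Fin 2) (Fin 2) ℂ}, (∀ b, w 1 b * ‖A b‖ < R) → ∀ idx : BondIdx D,
      ‖chartLogFlat (((F.L : ℝ)⁻¹) ^ (K - n)) D A idx‖ ≤ 8 * (F.L : ℝ) * R :=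
  ⟨differentiableOn_chartLogFlat_weightedBall F n K D hDk (collar_of_adm22 D hAdm hRM) hw hC₁ hstep hR,
    fun hA idx => norm_chartLogFlat_le_weightedBall F n K D hDk (collar_of_adm22 D hAdm hRM) hw hC₁ hstep hR hA idx⟩

end Weighted

end Summit.QuantumFields.YangMills.Theorems.Prop8ChartDoubleBar

end
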